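import Literature.Probability.RandomPlanarGeometry.SAWQuantitativeHWProduct
import Literature.Probability.RandomPlanarGeometry.SAWSubBallisticExplicit
import Literature.Probability.RandomPlanarGeometry.HammersleyWelshSharp
import Literature.Probability.RandomPlanarGeometry.BDGS2012CountBoundsProofs
import Mathlib.Analysis.Real.Pi.Bounds
import HarnessLib

/-!
# Explicit Hammersley–Welsh on `ℤ²` with the constant `π(1/3)^{1/2}`:
# `c_N ≤ e^{π√(N/3) + π²/6 + 1} · μ^{N+1}` for every `N ≥ 791`

Topic `Literature/Probability/RandomPlanarGeometry`, on top of `SAWQuantitativeHWProduct.lean` (product-form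
Hutchcroft Theorem 1.4: `Zd.count_le_exp_sharp_of_window`, exponent `π√(2/(3ℓ))` under a window at aspect ratio
`1/ℓ`) and `SAWSubBallisticExplicit.lean` (the lane's certified speed-`1/2` endpoint bound on `ℤ²`,
`SAW.card_xEnd_ge_half_le_exp : #{ω ∈ SAW_n : x(ω_n) ≥ n/2} ≤ 2^41 e^{-n/29} c_n`, all `n`; weighted finite-memory
automata, `native_decide` certificates).

Sources (printed anchors): J. M. Hammersley, D. J. A. Welsh (1962) / N. Madras, G. Slade (1993), Theorem 3.1.1:
"`c_N ≤ μ^{N+1} e^{BN^{1/2}}` for all `N ≥ N₀(B)`, any `B > π(2/3)^{1/2}`"; T. Hutchcroft (2018), Theorem 1.2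
(`c_n ≤ exp[o(n^{1/2})] μ_c^n`, ineffective) and Theorem 1.4; H. Duminil-Copin, A. Hammond (2013), Theorem 1.1
(sub-ballisticity). What is new in THIS FILE (lane pcv-sawmu, item X19b; not in print): an EFFECTIVE bound on `ℤ²`
with the `√N`-constant `π(1/3)^{1/2} ≈ 1.8138 < π(2/3)^{1/2} ≈ 2.5651` and an explicit threshold `N ≥ 791`.
Chain: certified endpoint bound at speed `1/2` ⇒ Hutchcroft window at aspect ratio `1/2` with every rate `c < 1/29`
(`bridgeHeightDecayWindow_two_of_certificate`, explicit prefactor `16 W e^{π²/(3(ε-c))}/(ε-c)`) ⇒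
`Zd.count_le_exp_sharp_of_window` at `ℓ = 2`, `c = 1/30`. AXIOMS: the computational lineage of the certificate
(`native_decide` in `SAWTiltedFiniteMemory16T25x16.lean` and `SAWLowerBound2604.lean`) — nothing else beyond the
standard three.

## Contents (namespace `Literature.Probability.RandomPlanarGeometry.SAW.Zd`), all PROVED
* `mul_exp_sqrt_exp_neg_le` — `m e^{π√(2m/3)} e^{-δm} ≤ (2/δ) e^{π²/(3δ)}`;
* `bridgeHeightDecayWindow_two_of_endpointBound` — an all-`n` relative endpoint bound at speed `1/2` with rate `ε`
  gives `Zd.BridgeHeightDecayWindow 2 2 A c` for every `0 ≤ c < ε`;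
* `bridgeHeightDecayWindow_two_two` — hence, from the certificate, the window for every `0 < c < 1/29`;
* **`count_le_exp_sharp_two_of_rate`** — `∀ 0 < c < 1/29, ∀ N ≥ 4` with `π²(1+c)² ≤ 12c²N`:
  `c_N ≤ e^{π√(N/3)+π²/6+1} μ^{N+1}`;
* **`count_le_exp_sharp_two`** — the same for every `N ≥ 791` (`c = 1/30`).
-/

noncomputable section

open Finset Literature.Probability.RandomPlanarGeometry.SAW

namespace Literature.Probability.RandomPlanarGeometry.SAW.Zd

/-- The elementary absorption: for `δ > 0` and real `m ≥ 0`, `m · e^{π√(2m/3)} · e^{-δ m} ≤ (2/δ) e^{π²/(3δ)}`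
(AM–GM `π√(2m/3) ≤ δm/2 + π²/(3δ)` and `m ≤ (2/δ)e^{δm/2}`). [cite: Hutchcroft2018HammersleyWelsh, §1 (prefactors are immaterial: eq. (1.1) vs Lemma 2.4)] -/
theorem mul_exp_sqrt_exp_neg_le {δ : ℝ} (hδ : 0 < δ) {m : ℝ} (hm : 0 ≤ m) :
    m * Real.exp (Real.pi * Real.sqrt (2 * m / 3)) * Real.exp (-(δ * m)) ≤
      2 / δ * Real.exp (Real.pi ^ 2 / (3 * δ)) := by
  have hπ : 0 ≤ Real.pi := Real.pi_pos.le
  have hamgm : Real.pi * Real.sqrt (2 * m / 3) ≤ δ * m / 2 + Real.pi ^ 2 / (3 * δ) := by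
    set s : ℝ := Real.sqrt (2 * m / 3) with hs_def
    have hs2 : s ^ 2 = 2 * m / 3 := Real.sq_sqrt (by positivity)
    have hm' : m = 3 * s ^ 2 / 2 := by rw [hs2]; ring
    rw [hm', show δ * (3 * s ^ 2 / 2) / 2 + Real.pi ^ 2 / (3 * δ) = (9 * δ ^ 2 * s ^ 2 + 4 * Real.pi ^ 2) / (12 * δ) by
      field_simp; ring, le_div_iff₀ (by positivity)]
    nlinarith [sq_nonneg (3 * δ * s - 2 * Real.pi)]
  have hlin : m ≤ 2 / δ * Real.exp (δ * m / 2) := by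
    have := Real.add_one_le_exp (δ * m / 2)
    rw [div_mul_eq_mul_div, le_div_iff₀ hδ]
    nlinarith
  have hE0 : 0 ≤ Real.exp (Real.pi * Real.sqrt (2 * m / 3)) * Real.exp (-(δ * m)) := by positivity
  calc m * Real.exp (Real.pi * Real.sqrt (2 * m / 3)) * Real.exp (-(δ * m))
      = m * (Real.exp (Real.pi * Real.sqrt (2 * m / 3)) * Real.exp (-(δ * m))) := by ring
    _ ≤ 2 / δ * Real.exp (δ * m / 2) * (Real.exp (Real.pi * Real.sqrt (2 * m / 3)) * Real.exp (-(δ * m))) :=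
        mul_le_mul_of_nonneg_right hlin hE0
    _ = 2 / δ * Real.exp (δ * m / 2 + Real.pi * Real.sqrt (2 * m / 3) + -(δ * m)) := by
        rw [Real.exp_add, Real.exp_add]; ring
    _ ≤ 2 / δ * Real.exp (Real.pi ^ 2 / (3 * δ)) := by
        gcongr
        linarith

/-- **Endpoint bound at speed `1/2` ⇒ Hutchcroft window at aspect ratio `1/2`**: if
`#{ω ∈ SAW_m(ℤ²) : ω_m(0) ≥ m/2} ≤ W e^{-εm} c_m` for all `m ≥ 1` (`W > 0`), then for every `0 ≤ c < ε`,
`Zd.BridgeHeightDecayWindow 2 2 A c` holds with `A = 16 W e^{π²/(3(ε-c))}/(ε-c)`: a bridge of length `m ≤ 2n` and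
height `≥ n` is an `m`-step SAW with `ω_m(0) ≥ m/2`; `c_m ≤ 4 c_{m-1} ≤ 4 m e^{π√(2m/3)} b_m`
(`Zd.count_le_sharp_mul_bridgeCount`); the surplus `e^{-(ε-c)m}` absorbs `m e^{π√(2m/3)}`.
[cite: Hutchcroft2018HammersleyWelsh, eq. (1.1) and Lemma 2.4 (windowed reading); DuminilCopinHammond2013, Theorem 1.1] -/
theorem bridgeHeightDecayWindow_two_of_endpointBound {W ε : ℝ} (hW : 0 < W)
    (h : ∀ m : ℕ, 1 ≤ m → ((((saws 2 m).filter fun ω => (1 / 2 : ℝ) * m ≤ ((ω m 0 : ℤ) : ℝ)).card : ℝ)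
      ≤ W * Real.exp (-(ε * m)) * (count 2 m : ℝ)))
    {c : ℝ} (hc0 : 0 ≤ c) (hcε : c < ε) :
    BridgeHeightDecayWindow 2 2 (4 * W * 2 * (2 / (ε - c) * Real.exp (Real.pi ^ 2 / (3 * (ε - c))))) c := by
  classical
  set δ : ℝ := ε - c with hδ
  have hδ0 : 0 < δ := by rw [hδ]; linarith
  intro m n hn hnm hm2
  have hm1 : 1 ≤ m := le_trans hn hnm
  have hm0 : (0 : ℝ) ≤ (m : ℝ) := Nat.cast_nonneg m
  have hsub : ((bridges 2 m).filter fun ω => (n : ℤ) ≤ ω m 0) ⊆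
      (saws 2 m).filter fun ω => (1 / 2 : ℝ) * m ≤ ((ω m 0 : ℤ) : ℝ) := by
    intro ω hω
    rw [Finset.mem_filter] at hω ⊢
    refine ⟨(mem_bridges.1 hω.1).1, ?_⟩
    have h1 : (m : ℝ) ≤ 2 * n := by exact_mod_cast hm2
    have h2 : ((n : ℤ) : ℝ) ≤ ((ω m 0 : ℤ) : ℝ) := by exact_mod_cast hω.2
    push_cast at h2
    linarith
  have hX : (((bridges 2 m).filter fun ω => (n : ℤ) ≤ ω m 0).card : ℝ) ≤
      W * Real.exp (-(ε * m)) * (count 2 m : ℝ) :=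
    le_trans (by exact_mod_cast Finset.card_le_card hsub) (h m hm1)
  obtain ⟨k, rfl⟩ : ∃ k, m = k + 1 := ⟨m - 1, by omega⟩
  have hc4 : (count 2 (k + 1) : ℝ) ≤ 4 * count 2 k := by
    have h1 := count_add_le 2 k 1
    have h2 := count_one_le 2
    have : count 2 (k + 1) ≤ 4 * count 2 k :=
      h1.trans (by calc count 2 k * count 2 1 ≤ count 2 k * (2 * 2) := Nat.mul_le_mul_left _ h2
        _ = 4 * count 2 k := by ring)
    exact_mod_cast this
  have hsharp := count_le_sharp_mul_bridgeCount (d := 2) k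
  have habs := mul_exp_sqrt_exp_neg_le hδ0 hm0
  have hcn : Real.exp (-(c * ((k + 1 : ℕ) : ℝ))) ≤ Real.exp (-(c * n)) := by
    rw [Real.exp_le_exp]
    have : (n : ℝ) ≤ ((k + 1 : ℕ) : ℝ) := by exact_mod_cast hnm
    nlinarith
  have hsplit : Real.exp (-(ε * ((k + 1 : ℕ) : ℝ))) =
      Real.exp (-(δ * ((k + 1 : ℕ) : ℝ))) * Real.exp (-(c * ((k + 1 : ℕ) : ℝ))) := by
    rw [← Real.exp_add, hδ]; ring_nf
  calc (((bridges 2 (k + 1)).filter fun ω => (n : ℤ) ≤ ω (k + 1) 0).card : ℝ)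
      ≤ W * Real.exp (-(ε * ((k + 1 : ℕ) : ℝ))) * (count 2 (k + 1) : ℝ) := hX
    _ ≤ W * Real.exp (-(ε * ((k + 1 : ℕ) : ℝ))) * (4 * (((k : ℕ) : ℝ) + 1) *
          Real.exp (Real.pi * Real.sqrt (2 * ((k : ℝ) + 1) / 3)) * bridgeCount 2 (k + 1)) := by
        refine mul_le_mul_of_nonneg_left (hc4.trans ?_) (mul_nonneg hW.le (Real.exp_nonneg _))
        linarith [hsharp]
    _ = 4 * W * ((((k + 1 : ℕ) : ℝ)) * Real.exp (Real.pi * Real.sqrt (2 * ((k + 1 : ℕ) : ℝ) / 3)) *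
          Real.exp (-(δ * ((k + 1 : ℕ) : ℝ)))) * Real.exp (-(c * ((k + 1 : ℕ) : ℝ))) *
          bridgeCount 2 (k + 1) := by
        rw [hsplit]; push_cast; ring
    _ ≤ 4 * W * (2 / δ * Real.exp (Real.pi ^ 2 / (3 * δ))) * Real.exp (-(c * n)) *
          bridgeCount 2 (k + 1) := by
        gcongr
    _ ≤ 4 * W * 2 * (2 / δ * Real.exp (Real.pi ^ 2 / (3 * δ))) * (bridgeCount 2 (k + 1) : ℝ) *
          Real.exp (-(c * n)) := by
        have h0 : 0 ≤ 4 * W * (2 / δ * Real.exp (Real.pi ^ 2 / (3 * δ))) * Real.exp (-(c * n)) *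
            bridgeCount 2 (k + 1) := by positivity
        nlinarith [h0]

/-- **The certified window on `ℤ²`**: for every `0 ≤ c < 1/29` there is `A` with `Zd.BridgeHeightDecayWindow 2 2 A c`
(from `SAW.card_xEnd_ge_half_le_exp`, `W = 2^41`, `ε = 1/29`).
[cite: DuminilCopinHammond2013, Theorem 1.1 (made explicit on `ℤ²` by the lane's certificate); Hutchcroft2018HammersleyWelsh, eq. (1.1)] -/
theorem bridgeHeightDecayWindow_two_two {c : ℝ} (hc0 : 0 ≤ c) (hc : c < 1 / 29) :
    ∃ A : ℝ, BridgeHeightDecayWindow 2 2 A c := by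
  refine ⟨_, bridgeHeightDecayWindow_two_of_endpointBound (W := 2 ^ 41) (ε := 1 / 29) (by norm_num) ?_ hc0 hc⟩
  intro m _
  have h := card_xEnd_ge_half_le_exp m
  have e : -((1 / 29 : ℝ) * (m : ℝ)) = -((m : ℝ) / 29) := by ring
  rw [e]
  exact h

/-- **Explicit Hammersley–Welsh on `ℤ²`, free auxiliary rate**: for every `0 < c < 1/29` and all `N ≥ 4` with
`π²(1+c)² ≤ 12c²N`, `c_N ≤ e^{π√(N/3) + π²/6 + 1} · μ^{N+1}` (`Zd.count_le_exp_sharp_of_window` at `ℓ = 2`; the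
prefactor `A` of the window is immaterial). [cite: MadrasSlade1993, Theorem 3.1.1; Hutchcroft2018HammersleyWelsh, Theorem 1.4] -/
theorem count_le_exp_sharp_two_of_rate {c : ℝ} (hc0 : 0 < c) (hc : c < 1 / 29) (N : ℕ) (hN : 4 ≤ N)
    (hNc : Real.pi ^ 2 * (1 + c) ^ 2 ≤ 12 * c ^ 2 * N) :
    (count 2 N : ℝ) ≤
      Real.exp (Real.pi * Real.sqrt (N / 3) + Real.pi ^ 2 / 6 + 1) * connectiveConstant 2 ^ (N + 1) := by
  obtain ⟨A, hA⟩ := bridgeHeightDecayWindow_two_two hc0.le hc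
  have hπ0 : 0 < Real.pi := Real.pi_pos
  have hN' : (4 : ℝ) ≤ N := by exact_mod_cast hN
  have hN1 : 2 * Real.pi ^ 2 ≤ 3 * ((2 : ℕ) : ℝ) * N := by
    push_cast
    nlinarith [Real.pi_lt_d2]
  have hN2 : Real.pi ^ 2 * ((((2 : ℕ) : ℝ) - 1) / c + 1) ^ 2 ≤ 6 * ((2 : ℕ) : ℝ) * N := by
    have e1 : ((((2 : ℕ) : ℝ) - 1) / c + 1) = (1 + c) / c := by
      push_cast
      field_simp
      ring
    rw [e1, div_pow, ← mul_div_assoc, div_le_iff₀ (by positivity)]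
    push_cast
    nlinarith
  have key := count_le_exp_sharp_of_window hA (by norm_num) hc0 N hN1 hN2
  have e2 : (2 * (N : ℝ) / (3 * ((2 : ℕ) : ℝ))) = N / 3 := by push_cast; ring
  have e3 : Real.pi ^ 2 / (3 * ((2 : ℕ) : ℝ)) = Real.pi ^ 2 / 6 := by push_cast; ring
  rw [e2, e3] at key
  exact key

/-- **Explicit Hammersley–Welsh on `ℤ²` with the constant `π(1/3)^{1/2}`: for every `N ≥ 791`,
`c_N ≤ e^{π√(N/3) + π²/6 + 1} · μ^{N+1}`** (`c = 1/30`; `75π²(31/30)² < 790.4` by `π < 3.1416`). Printed: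
`B > π(2/3)^{1/2}` with an inexplicit `N₀(B)` (Madras–Slade Theorem 3.1.1); here `π(1/3)^{1/2} + ` an explicit
additive constant, at the price of the lane's computational certificate.
[cite: MadrasSlade1993, Theorem 3.1.1; Hutchcroft2018HammersleyWelsh, Theorems 1.2 and 1.4; DuminilCopinHammond2013, Theorem 1.1] -/
theorem count_le_exp_sharp_two (N : ℕ) (hN : 791 ≤ N) :
    (count 2 N : ℝ) ≤
      Real.exp (Real.pi * Real.sqrt (N / 3) + Real.pi ^ 2 / 6 + 1) * connectiveConstant 2 ^ (N + 1) := by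
  have hN' : (791 : ℝ) ≤ N := by exact_mod_cast hN
  refine count_le_exp_sharp_two_of_rate (c := 1 / 30) (by norm_num) (by norm_num) N (by omega) ?_
  have hπ0 : 0 < Real.pi := Real.pi_pos
  have hπ1 : Real.pi < 3.1416 := Real.pi_lt_d4
  have hπ2 : Real.pi ^ 2 < 3.1416 ^ 2 := by nlinarith
  nlinarith

end Literature.Probability.RandomPlanarGeometry.SAW.Zd

end
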